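import Literature.Algebra.EuclideanLattices.PeriodizeSmooth
import HarnessLib

/-!
# Periodization of complex-valued bumps over a full lattice and its Fourier expansion

Topic `Literature/Algebra/EuclideanLattices`, continuing `LatticePeriodicFunctions` /
`PeriodizeSmooth` (real-valued `periodize`). For the TWISTED unit sums of the smooth
Bombieri–Vinogradov chain (a bump times a unitary character of `logSpace K`, periodized over the
FIXED lattice `L⁺` of totally positive units: Hecke 1920 §1, Mitsui 1956 §3) we need complex-valued
bumps `g : E → ℂ`:

* `periodizeC L g x = ∑_{ℓ ∈ L} g(x + ℓ)` (defined through the real and imaginary parts, so that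
  the whole real API transfers): `periodizeC_eq_tsum`, `periodizeC_add_of_mem`, `contDiff_periodizeC`;
* `mean_echar_mul_periodizeC` — `mean(e_{−k} · periodizeC g) = μ(fdom)⁻¹ ∫ g e_{−k}`;
* **`hasSum_echar_periodizeC`** — `∑_ℓ g(x+ℓ) = ∑_k μ(fdom)⁻¹ (∫ g e_{−k}) e_k(x)`;
* **`norm_coeff_periodizeC_le`** — decay of the coefficients from a bound on the iterated
  derivatives of the (smooth, periodic) periodization (`norm_mean_echar_mul_le`).

## References

* E. Hecke, Math. Z. 6 (1920), §1. [cite: HeckeMathZ1920, §1]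
* L. Grafakos, *Classical Fourier Analysis* (2014), §3.3. [cite: Grafakos2014, §3.3.3]
-/

noncomputable section

open MeasureTheory Module Submodule Filter Topology Complex Finset ZSpan
open scoped Real

namespace Literature.Algebra.EuclideanLattices.LatticePeriodic

variable {E : Type*} [NormedAddCommGroup E] [NormedSpace ℝ E] [FiniteDimensional ℝ E]
variable (L : Submodule ℤ E) [DiscreteTopology L] [IsZLattice ℝ L]

/-- `periodizeC L g x = ∑_{ℓ ∈ L} g(x + ℓ)` for complex `g`, via real and imaginary parts. [folklore] -/
def periodizeC (g : E → ℂ) (x : E) : ℂ :=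
  (periodize L (fun y => (g y).re) x : ℂ) + (periodize L (fun y => (g y).im) x : ℂ) * I

variable {L}

omit [NormedSpace ℝ E] [FiniteDimensional ℝ E] [DiscreteTopology L] [IsZLattice ℝ L] in
/-- Support transfer to the real and imaginary parts. [folklore] -/
theorem re_im_support {g : E → ℂ} {R : ℝ} (hg : ∀ y, R < ‖y‖ → g y = 0) :
    (∀ y, R < ‖y‖ → (fun y => (g y).re) y = 0) ∧ (∀ y, R < ‖y‖ → (fun y => (g y).im) y = 0) :=
  ⟨fun y hy => by simp [hg y hy], fun y hy => by simp [hg y hy]⟩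

/-- **`periodizeC L g x = ∑' ℓ, g (x + ℓ)`** for `g` supported in a ball. [folklore] -/
theorem periodizeC_eq_tsum {g : E → ℂ} {R : ℝ} (hg : ∀ y, R < ‖y‖ → g y = 0) (x : E) :
    periodizeC L g x = ∑' ℓ : L, g (x + ℓ) := by
  obtain ⟨hre, him⟩ := re_im_support hg
  have hfin : ∀ ℓ : L, ℓ ∉ ballPts (L := L) (R + ‖x‖) → g (x + ℓ) = 0 := fun ℓ hℓ => by
    rw [mem_ballPts, not_le] at hℓ
    refine hg _ ?_
    have h2 : ‖(ℓ : E)‖ ≤ ‖x + (ℓ : E)‖ + ‖x‖ := by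
      have := norm_sub_le (x + (ℓ : E)) x
      rwa [add_sub_cancel_left] at this
    linarith
  rw [tsum_eq_sum (s := ballPts (L := L) (R + ‖x‖)) hfin, periodizeC, periodize_eq_sum hre le_rfl,
    periodize_eq_sum him le_rfl, Complex.ofReal_sum, Complex.ofReal_sum, Finset.sum_mul, ← Finset.sum_add_distrib]
  exact Finset.sum_congr rfl fun ℓ _ => (Complex.re_add_im _)

omit [NormedSpace ℝ E] [FiniteDimensional ℝ E] [DiscreteTopology L] [IsZLattice ℝ L] in
/-- Periodicity. [folklore] -/
theorem periodizeC_add_of_mem (g : E → ℂ) {ℓ₀ : E} (hℓ₀ : ℓ₀ ∈ L) (x : E) :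
    periodizeC L g (x + ℓ₀) = periodizeC L g x := by
  unfold periodizeC
  rw [periodize_add_of_mem _ hℓ₀, periodize_add_of_mem _ hℓ₀]

/-- **Smoothness** of the periodization of a smooth complex bump. [folklore] -/
theorem contDiff_periodizeC {g : E → ℂ} (hc : ContDiff ℝ (⊤ : ℕ∞) g) {R : ℝ} (hg : ∀ y, R < ‖y‖ → g y = 0) :
    ContDiff ℝ (⊤ : ℕ∞) (periodizeC L g) := by
  obtain ⟨hre, him⟩ := re_im_support hg
  have h1 : ContDiff ℝ (⊤ : ℕ∞) fun y => (g y).re := Complex.reCLM.contDiff.comp hc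
  have h2 : ContDiff ℝ (⊤ : ℕ∞) fun y => (g y).im := Complex.imCLM.contDiff.comp hc
  unfold periodizeC
  exact (Complex.ofRealCLM.contDiff.comp (contDiff_periodize h1 hre)).add
    ((Complex.ofRealCLM.contDiff.comp (contDiff_periodize h2 him)).mul contDiff_const)

variable [MeasurableSpace E] [BorelSpace E] (μ : Measure E) [μ.IsAddHaarMeasure]

/-- **The Fourier coefficients of a complex periodization**:
`mean(e_{−k} · periodizeC g) = μ(fdom)⁻¹ ∫ g e_{−k}`. [cite: HeckeMathZ1920, §1] -/
theorem mean_echar_mul_periodizeC {g : E → ℂ} (hc : Continuous g) {R : ℝ} (hg : ∀ y, R < ‖y‖ → g y = 0)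
    (k : Fin (finrank ℝ E) → ℤ) :
    mean L μ (fun x => echar L (-k) x * periodizeC L g x) = (μ.real (fdom L))⁻¹ * ∫ x, g x * echar L (-k) x ∂μ := by
  obtain ⟨hre, him⟩ := re_im_support hg
  have hcre : Continuous fun y => (g y).re := Complex.continuous_re.comp hc
  have hcim : Continuous fun y => (g y).im := Complex.continuous_im.comp hc
  -- split into real and imaginary parts
  have hsplit : (fun x => echar L (-k) x * periodizeC L g x) =
      fun x => echar L (-k) x * (periodize L (fun y => (g y).re) x : ℂ) + I * (echar L (-k) x * (periodize L (fun y => (g y).im) x : ℂ)) := by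
    funext x; unfold periodizeC; ring
  have hi1 : IntegrableOn (fun x => echar L (-k) x * (periodize L (fun y => (g y).re) x : ℂ)) (fdom L) μ :=
    integrableOn_fdom L μ ((continuous_echar L (-k)).mul (Complex.continuous_ofReal.comp (continuous_periodize hcre hre)))
  have hi2 : IntegrableOn (fun x => I * (echar L (-k) x * (periodize L (fun y => (g y).im) x : ℂ))) (fdom L) μ :=
    (integrableOn_fdom L μ ((continuous_echar L (-k)).mul (Complex.continuous_ofReal.comp (continuous_periodize hcim him)))).const_mul I
  rw [hsplit, mean, integral_add hi1 hi2, integral_const_mul, Complex.real_smul, mul_add]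
  have h1 := mean_echar_mul_periodize (L := L) μ hcre hre k
  have h2 := mean_echar_mul_periodize (L := L) μ hcim him k
  rw [mean, Complex.real_smul] at h1 h2
  rw [h1, show (((μ.real (fdom L))⁻¹ : ℝ) : ℂ) * (I * ∫ a in fdom L, echar L (-k) a * (periodize L (fun y => (g y).im) a : ℂ) ∂μ) =
    I * ((((μ.real (fdom L))⁻¹ : ℝ) : ℂ) * ∫ a in fdom L, echar L (-k) a * (periodize L (fun y => (g y).im) a : ℂ) ∂μ) by ring, h2]
  -- reassemble `g = re + i im`
  have hint : ∀ f : E → ℝ, Continuous f → (∀ y, R < ‖y‖ → f y = 0) → Integrable (fun x => (f x : ℂ) * echar L (-k) x) μ := by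
    intro f hf hfz
    refine ((Complex.continuous_ofReal.comp hf).mul (continuous_echar L (-k))).integrable_of_hasCompactSupport ?_
    refine HasCompactSupport.of_support_subset_isCompact (isCompact_closedBall (0 : E) R) fun y hy => ?_
    rw [Metric.mem_closedBall, dist_zero_right]
    by_contra h'
    exact hy (by simp [hfz y (not_le.1 h')])
  have hgsplit : (fun x => g x * echar L (-k) x) =
      fun x => ((g x).re : ℂ) * echar L (-k) x + I * (((g x).im : ℂ) * echar L (-k) x) := by
    funext x
    conv_lhs => rw [← Complex.re_add_im (g x)]
    ring
  rw [hgsplit, integral_add (hint _ hcre hre) ((hint _ hcim him).const_mul I), integral_const_mul]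
  push_cast
  ring

/-- **The Fourier expansion of a periodized smooth complex bump**:
`∑_ℓ g(x + ℓ) = ∑_k μ(fdom)⁻¹ (∫ g e_{−k}) e_k(x)`, absolutely convergent. [cite: HeckeMathZ1920, §1] -/
theorem hasSum_echar_periodizeC {g : E → ℂ} (hc : ContDiff ℝ (⊤ : ℕ∞) g) {R : ℝ} (hg : ∀ y, R < ‖y‖ → g y = 0) (x : E) :
    HasSum (fun k : Fin (finrank ℝ E) → ℤ => ((μ.real (fdom L))⁻¹ * ∫ y, g y * echar L (-k) y ∂μ) * echar L k x)
      (periodizeC L g x) := by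
  have hper : ∀ ℓ ∈ L, ∀ y, periodizeC L g (y + ℓ) = periodizeC L g y := fun ℓ hℓ y => periodizeC_add_of_mem g hℓ y
  have hs := hasSum_echar (L := L) μ (contDiff_periodizeC hc hg) hper x
  refine hs.congr_fun fun k => ?_ |> fun h' => h'
  rw [mean_echar_mul_periodizeC μ hc.continuous hg k]

/-- **Decay of the coefficients** from a bound on the derivatives of the periodization:
`‖μ(fdom)⁻¹ ∫ g e_{−k}‖ ≤ D ‖b_j‖^m / (2π|k_j|)^m` whenever `‖D^m (periodizeC g)‖ ≤ D`.
[cite: Grafakos2014, Thm. 3.3.9] -/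
theorem norm_coeff_periodizeC_le {g : E → ℂ} (hc : ContDiff ℝ (⊤ : ℕ∞) g) {R : ℝ} (hg : ∀ y, R < ‖y‖ → g y = 0)
    (j : Fin (finrank ℝ E)) (m : ℕ) {k : Fin (finrank ℝ E) → ℤ} (hk : k j ≠ 0) {D : ℝ}
    (hD : ∀ x, ‖iteratedFDeriv ℝ m (periodizeC L g) x‖ ≤ D) :
    ‖(μ.real (fdom L))⁻¹ * ∫ y, g y * echar L (-k) y ∂μ‖ ≤ D * ‖rBasis L j‖ ^ m / (2 * Real.pi * |(k j : ℝ)|) ^ m := by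
  have hper : ∀ ℓ ∈ L, ∀ y, periodizeC L g (y + ℓ) = periodizeC L g y := fun ℓ hℓ y => periodizeC_add_of_mem g hℓ y
  rw [← mean_echar_mul_periodizeC μ hc.continuous hg k]
  exact norm_mean_echar_mul_le μ (contDiff_periodizeC hc hg) hper j m hk hD

/-- **Trivial bound**: `‖μ(fdom)⁻¹ ∫ g e_{−k}‖ ≤ μ(fdom)⁻¹ ∫ ‖g‖`. [folklore] -/
theorem norm_coeff_le_integral_norm (g : E → ℂ) (k : Fin (finrank ℝ E) → ℤ) :
    ‖(μ.real (fdom L))⁻¹ * ∫ y, g y * echar L (-k) y ∂μ‖ ≤ (μ.real (fdom L))⁻¹ * ∫ y, ‖g y‖ ∂μ := by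
  rw [norm_mul, Complex.norm_real, Real.norm_eq_abs, abs_of_pos (inv_pos.2 (measureReal_fdom_pos L μ))]
  refine mul_le_mul_of_nonneg_left ?_ (inv_nonneg.2 (measureReal_fdom_pos L μ).le)
  refine (norm_integral_le_integral_norm _).trans (le_of_eq ?_)
  refine integral_congr_ae (Eventually.of_forall fun y => ?_)
  simp only [norm_mul, norm_echar, mul_one]

end Literature.Algebra.EuclideanLattices.LatticePeriodic
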